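import Literature.MathematicalPhysics.QuantumFieldTheory.Balaban1983to89.B5AveragingLocalityV1

/-!
# `Balaban1983to89.B6SectADomainsV1` — T. Bałaban, *Propagators and renormalization transformations for lattice gauge
# theories. II*, Commun. Math. Phys. **96** (1984) 223–250 [Balaban1984PropagatorsII], Sect. A (2.1)–(2.7), (2.10), (2.20)
# ON THE V1 MULTI-LEVEL TORUS CALCULUS `LatticeFieldCalculus`: the nested domains `Ω_j = B^j(Ω_j^{(j)})`, the sets `Λ_j` of
# SITES AND OF BONDS (2.3) with the p. 224 convention *"Ω also the set of bonds ⋃_{x∈Ω} st(x)"*, the gauge space `N(Q′)`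
# (2.7)/(2.10), the multi-scale constraints (2.6)/(2.20) — and the sentence *"The functional and the conditions are invariant
# with respect to gauge transformations λ … (2.7)"* (p. 224) / *"Because Q′λ′ = 0, hence QA^{λ′} = QA − ∂₁Q′λ′ = QA"* (p. 227)
# PROVED for the multi-level averaging `Q`

statement-level skeleton of published theorems with citation tags; proofs where landed; nothing here is a claim about the
Yang–Mills mass gap

PDF held: `paper:balaban1984-cmp96-propagators-rt-ii` (journal page = PDF page + 222); pp. 224–228 read AS IMAGES on the ×2
renders `run/shared/lean/pub/pub-balaban/b2b-balaban-ref1/pages/1984-cmp96-propagators-rt-II/…-p002…p006-x2.png` (this seat,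
2026-08-21).

CITATION HEADER (lean-in-tree rule).  Cell `lit-balaban` (HOME `run/shared/lean/pub/lit-balaban/`), PHASE-2 proof seat **p21**
(gen 5), B6 fold owner r03, referee ref-4.  WHAT IS REPRODUCED: SKELETON rows **B6.Eq2.3** (the *"sets of bonds"* reading of
`Λ_j`, recorded in ROWS-B6 as *"not modelled"* on the concrete carriers), **B6.Eq2.7** ((2.7)/(2.10) `N(Q′)` and the gauge
invariance of (2.6)), **B6.Eq2.19** ((2.20): the multi-level `Q`) — as a MODEL INSTANCE on the carriers OF RECORD of the series'
shared vocabulary: the tori `T^{(j)}` = `Site P j` of `…Balaban1983to89.Setup`, bond fields `VecField P j ℝ`, site functions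
`SiteField P j ℝ`, the `k`-fold averages `Q_j = LatticeFieldCalculus.bondAvgIter j` (1.16)–(1.18) and `Q′_j = siteAvgIter j`
(1.20) of [Balaban1984PropagatorsI] (r18, p239006), their one-stroke unfoldings `…B5Eq118OneStroke` (p39) and the identity
`Q_j∂ = ∂^{(j)}Q′_j` `…B5Eq120IterProof.bondAvgIter_grad` (1.20).  This is file 1/3 of r03's ranked Phase-2 target P2
(*"(2.31)/(2.34) as theorems for the concrete lattice operators, then `B6SectA.critical221_unique` becomes unconditional"*):
file 2 `…B6SectAZeroModesV1` (zero modes, (2.11) qualitative, `Q`, `Q′` onto), file 3 `…B6SectAVectorModelV1` (Δ_a (2.19)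
positive definite, (2.31)/(2.34)/(2.35) unconditional).  Nothing of the abstract files `…B6SectA` (p238845), `…B6Eq231`,
`…B6Eq218Lagrangian` is restated; they are instantiated in file 3.

PRINT (pp. 224–227, verbatim).  *"We consider a sequence of domains Ω₁ ⊃ Ω₂ ⊃ … ⊃ Ω_k, Ω_j ⊂ T_η, j = 1, 2, …, k, (2.1) which
satisfy the following conditions: Ω_j = B^j(Ω_j^{(j)}), Ω_j^{(j)} ⊂ T^{(j)}_{L^jη} and it is a sum of big blocks,
(L^jη)⁻¹dist(Ω_j^c, Ω_{j+1}) > RM … (2.2) … The above sets are subsets of T_η, thus sets of sites of this lattice, but we will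
apply the same notations to sets of bonds defined in the following way. If Ω ⊂ T_η, then we denote by Ω also the set of bonds
⋃_{x∈Ω} st(x) = {bonds b ⊂ T_η: at least one end-point of b belongs to Ω}. Let us define Λ_j = Ω_j^{(j)} ∖ Ω_{j+1}^{(j)},
j = 1, …, k − 1, Λ_k = Ω_k^{(k)}, Λ₀ = Ω₁^c (2.3) for the sets of sites and the sets of bonds; thus we have Ω₁ = ⋃_{j=1}^k B^j(Λ_j),
T = ⋃_{j=0}^k B^j(Λ_j), where B⁰(Λ₀) = Λ₀. (2.4) Let us notice that we admit the case when some domains Ω_j are equal to T_η …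
A = B₀ on Λ₀, Q_jA = B_j on Λ_j, j = 1, …, k. (2.6) The functional and the conditions are invariant with respect to gauge
transformations λ: A → A^λ = A − ∂λ such that λ = 0 on Λ₀, Q′_jλ = 0 on Λ_j, j = 1, …, k. (2.7)"*; p. 225 *"N(Q′) = {λ: λ
satisfies (2.7)}, (2.10)"*; p. 226 *"(QA)(b) = (Q_jA)(b) for b ∈ Λ_j, (Q₀A)(b) = A(b). (2.20)"*; p. 227 *"Because Q′λ′ = 0,
hence QA^{λ′} = QA − ∂₁Q′λ′ = QA"*.

TYPED READING (every choice displayed).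
* `Domains P` = (2.1): `Om j ⊆ Site P j` is `Ω_j^{(j)}` (a `Finset`), `j = 1, …, k`, with `Om 0 = T` (so that `Λ₀ = Ω₁ᶜ` is the
  `j = 0` instance of (2.3)) and `Om j = ∅` for `j > k`; NESTING `Ω_{j+1} ⊆ Ω_j` of (2.1) is recorded blockwise
  (`nested : blockOf y ∈ Om (j+1) → y ∈ Om j`, i.e. `B^{j+1}(Ω_{j+1}^{(j+1)}) ⊆ B^j(Ω_j^{(j)})`).  The two quantitative clauses of
  (2.2) (*"a sum of big blocks"*, the separation `RM`) are NOT used by anything proved in files 1–3 and are therefore not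
  fields: every statement holds for every nested family, in particular for the printed ones.  Standing range `k ≤ m + K` of
  `Setup` (`hk`).
* (2.3) `Ω_{j+1}^{(j)}` = the `j`-blocks inside `Ω_{j+1}`: `Deep j y :↔ blockOf y ∈ Om (j+1)`.  SITES: `LamSite j y :↔ y ∈ Om j ∧
  ¬Deep j y`.  BONDS, with the p. 224 star convention `st_j(Ω) = {b : b₋ ∈ Ω ∨ b₊ ∈ Ω}` applied to the set difference (2.3):
  `LamBond j b :↔ (b₋ ∈ Om j ∨ b₊ ∈ Om j) ∧ ¬Deep j b₋ ∧ ¬Deep j b₊` = `st_j(Ω_j^{(j)}) ∖ st_j(Ω_{j+1}^{(j)})`; at `j = 0` this is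
  *"both end-points in Ω₁ᶜ"*, at `j = k` it is `st_k(Ω_k^{(k)})`.  With this reading the constraints (2.6) ARE invariant under
  (2.7) (`constr_gaugeShift_iff`); with the weaker reading *"at least one end-point in Λ_j"* they are not (a bond from `Λ_j` into
  a `j`-block inside `Ω_{j+1}` has an unconstrained `Q′_jλ` at that end).
* (2.6)/(2.20): `Constr D A B :↔ ∀ j b, LamBond j b → bondAvgIter j A b = B j b` (`Q₀ = bondAvgIter 0 = id`: *"(Q₀A)(b) = A(b)"*).
  (2.7)/(2.10): `InGauge D λ :↔ ∀ j y, LamSite j y → siteAvgIter j λ y = 0` (`siteAvgIter 0 = id`: *"λ = 0 on Λ₀"*).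
WHAT IS PROVED (0 sorry, 0 new named facts; axioms standard; the block locality of the one-level averages is the support
file `…B5AveragingLocalityV1`).  §1 the data and `N(Q′)` as a submodule (`gaugeSpace`); §2 **Lemma S**
`siteAvgIter_eq_zero_of_inGauge`: `λ ∈ N(Q′) ⇒ Q′_jλ(y) = 0` for EVERY `j`-block `y` not inside `Ω_{j+1}` (not only on `Λ_j`;
induction over the levels), in particular `Q′_kλ ≡ 0` on `T^{(k)}`; §3 **Lemma V** `bondAvgIter_eq_zero_of_constr_zero`:
`QA = 0 ⇒ Q_jA(b) = 0` for every `j`-bond with both end-points outside `Ω_{j+1}`, in particular `Q_kA ≡ 0`; §4 the p. 224 / p. 227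
sentences: `bondAvgIter_gaugeShift_of_inGauge` (`Q_jA^λ = Q_jA` on those bonds for `λ ∈ N(Q′)`), **`constr_gaugeShift_iff`**
((2.6) is invariant under (2.7)); the invariance of the functional (2.5) is `LatticeFieldCalculus.curlAction_gaugeShift` (r18);
§5 **(2.4)**: every fine site lies over exactly one `Λ_j` (`exists_lamSite_iterBlockOf`, `lamSite_iterBlockOf_unique`).
-/

namespace Literature.MathematicalPhysics.QuantumFieldTheory.Balaban1983to89.B6SectADomainsV1

open LatticeFieldCalculus B5Eq118OneStroke B5Eq120IterProof B5AveragingLocalityV1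
open BalabanImbrieJaffe1984to88.BIJ85AxialPropagator411 (bondAvg_add bondAvg_smul bondAvg_zero bondAvgIter_add bondAvgIter_smul
  bondAvgIter_map_zero)
open BalabanImbrieJaffe1984to88.BIJ85GaugeFunction5113 (siteAvg_add siteAvg_sub siteAvg_smul siteAvgIter_add siteAvgIter_sub
  siteAvgIter_smul grad_add grad_sub grad_smul grad_zero)
open BalabanImbrieJaffe1984to88.BIJ85Eq5113Proof (bondAvgIter_sub)

noncomputable section

variable {P : Params} {j : ℕ}

/-! ## §1. The nested domains (2.1), the sets `Λ_j` of sites and bonds (2.3), `N(Q′)` (2.7)/(2.10), the constraints (2.6)/(2.20) -/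

variable (P) in
/-- **(2.1)–(2.3)**: a nested family of domains `Ω₁ ⊃ Ω₂ ⊃ … ⊃ Ω_k`, `Ω_j = B^j(Ω_j^{(j)})`, `Ω_j^{(j)} ⊂ T^{(j)}` — recorded by the
finite sets `Om j = Ω_j^{(j)}` of sites of `T^{(j)}` (`Om 0 = T`, `Om j = ∅` for `j > k`) and the blockwise nesting
`B^{j+1}(Ω_{j+1}^{(j+1)}) ⊆ B^j(Ω_j^{(j)})`; standing range `k ≤ m + K`.  The clauses *"a sum of big blocks"* and
`(L^jη)⁻¹dist(Ω_j^c, Ω_{j+1}) > RM` of (2.2) are not recorded (not used in Sect. A's algebra). [cite: Balaban1984PropagatorsII, (2.1)–(2.3) p.224] -/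
structure Domains where
  /-- the number `k` of levels -/
  k : ℕ
  /-- standing range of `Setup` -/
  hk : k ≤ P.m + P.K
  /-- `Ω_j^{(j)} ⊂ T^{(j)}` -/
  Om : (j : ℕ) → Finset (Site P j)
  /-- `Ω₀ := T` -/
  Om_zero : Om 0 = Finset.univ
  /-- no domains beyond level `k` -/
  Om_eq_empty : ∀ ⦃j : ℕ⦄, k < j → Om j = ∅
  /-- `Ω_{j+1} ⊆ Ω_j` -/
  nested : ∀ ⦃j : ℕ⦄ (y : Site P j), blockOf y ∈ Om (j + 1) → y ∈ Om j

namespace Domains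

variable (D : Domains P)

/-- *"we admit the case when some domains Ω_j are equal to T_η, for example Ω_j = T_η for j = 1, 2, …, l"* (p. 224) — with
`l = k`: all domains the whole torus (then `Λ_j = ∅` for `j < k` and `Λ_k = T^{(k)}`: the one-level problem of
[Balaban1984PropagatorsI]).  Non-vacuity witness. [cite: Balaban1984PropagatorsII, (2.1) p.224] -/
def whole (k : ℕ) (hk : k ≤ P.m + P.K) : Domains P where
  k := k
  hk := hk
  Om j := if j ≤ k then Finset.univ else ∅
  Om_zero := by simp
  Om_eq_empty j hj := by simp [not_le.mpr hj]
  nested j y _ := by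
    by_cases h : j ≤ k
    · simp [h]
    · have h' : ¬ j + 1 ≤ k := by omega
      simp_all

/-- `Ω_{j+1}^{(j)}`: the `j`-block `y` lies inside `Ω_{j+1}` (its `(j+1)`-block belongs to `Ω_{j+1}^{(j+1)}`). [cite: Balaban1984PropagatorsII, (2.3) p.224] -/
def Deep (j : ℕ) (y : Site P j) : Prop := blockOf y ∈ D.Om (j + 1)

/-- decidability of `Deep`. [cite: Balaban1984PropagatorsII, (2.3) p.224] -/
instance instDecidableDeep (j : ℕ) (y : Site P j) : Decidable (D.Deep j y) :=
  inferInstanceAs (Decidable (blockOf y ∈ D.Om (j + 1)))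

/-- **(2.3), SITES**: `Λ_j = Ω_j^{(j)} ∖ Ω_{j+1}^{(j)}` (`Λ_k = Ω_k^{(k)}`, `Λ₀ = Ω₁ᶜ`). [cite: Balaban1984PropagatorsII, (2.3) p.224] -/
def LamSite (j : ℕ) (y : Site P j) : Prop := y ∈ D.Om j ∧ ¬ D.Deep j y

/-- **(2.3), BONDS** (p. 224: *"Ω also the set of bonds ⋃_{x∈Ω} st(x) = {bonds b: at least one end-point of b belongs to Ω}"*):
`Λ_j = st_j(Ω_j^{(j)}) ∖ st_j(Ω_{j+1}^{(j)})` — at least one end-point in `Ω_j^{(j)}`, no end-point inside `Ω_{j+1}`. [cite: Balaban1984PropagatorsII, (2.3) p.224] -/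
def LamBond (j : ℕ) (b : PBond P j) : Prop := (b.src ∈ D.Om j ∨ b.tgt ∈ D.Om j) ∧ ¬ D.Deep j b.src ∧ ¬ D.Deep j b.tgt

/-- decidability of `LamSite`. [cite: Balaban1984PropagatorsII, (2.3) p.224] -/
instance instDecidablePredLamSite (j : ℕ) : DecidablePred (D.LamSite j) := fun y =>
  inferInstanceAs (Decidable (y ∈ D.Om j ∧ ¬ D.Deep j y))

/-- decidability of `LamBond`. [cite: Balaban1984PropagatorsII, (2.3) p.224] -/
instance instDecidablePredLamBond (j : ℕ) : DecidablePred (D.LamBond j) := fun b =>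
  inferInstanceAs (Decidable ((b.src ∈ D.Om j ∨ b.tgt ∈ D.Om j) ∧ ¬ D.Deep j b.src ∧ ¬ D.Deep j b.tgt))

/-- `Ω_j ⊂ T_η` as a set of sites of the fine lattice: `x ∈ Ω_j = B^j(Ω_j^{(j)})` iff the `j`-fold block point of `x` is in
`Ω_j^{(j)}`. [cite: Balaban1984PropagatorsII, (2.2) p.224] -/
def InOm (j : ℕ) (x : Site P 0) : Prop := iterBlockOf j x ∈ D.Om j

/-- `Λ₀ = Ω₁ᶜ` (sites): at level `0` the condition `x ∈ Ω₀ = T` is void. [cite: Balaban1984PropagatorsII, (2.3) p.224] -/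
theorem lamSite_zero_iff (x : Site P 0) : D.LamSite 0 x ↔ ¬ D.Deep 0 x := by
  simp [LamSite, D.Om_zero]

/-- `Λ₀ = Ω₁ᶜ` (bonds): both end-points outside `Ω₁`. [cite: Balaban1984PropagatorsII, (2.3) p.224] -/
theorem lamBond_zero_iff (b : PBond P 0) : D.LamBond 0 b ↔ ¬ D.Deep 0 b.src ∧ ¬ D.Deep 0 b.tgt := by
  simp [LamBond, D.Om_zero]

/-- beyond the top level nothing is deep: `Ω_{j+1} = ∅` for `j ≥ k`. [cite: Balaban1984PropagatorsII, (2.3) p.224] -/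
theorem not_deep_of_le {j : ℕ} (hj : D.k ≤ j) (y : Site P j) : ¬ D.Deep j y := by
  simp [Deep, D.Om_eq_empty (Nat.lt_succ_of_le hj)]

/-- `Λ_k = Ω_k^{(k)}` (sites). [cite: Balaban1984PropagatorsII, (2.3) p.224] -/
theorem lamSite_top_iff (y : Site P D.k) : D.LamSite D.k y ↔ y ∈ D.Om D.k := by
  simp [LamSite, D.not_deep_of_le le_rfl]

/-- `Λ_k = st_k(Ω_k^{(k)})` (bonds). [cite: Balaban1984PropagatorsII, (2.3) p.224] -/
theorem lamBond_top_iff (b : PBond P D.k) : D.LamBond D.k b ↔ b.src ∈ D.Om D.k ∨ b.tgt ∈ D.Om D.k := by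
  simp [LamBond, D.not_deep_of_le le_rfl]

/-- no `Λ_j` beyond level `k` (sites). [cite: Balaban1984PropagatorsII, (2.3) p.224] -/
theorem not_lamSite_of_lt {j : ℕ} (hj : D.k < j) (y : Site P j) : ¬ D.LamSite j y := by
  simp [LamSite, D.Om_eq_empty hj]

/-- no `Λ_j` beyond level `k` (bonds). [cite: Balaban1984PropagatorsII, (2.3) p.224] -/
theorem not_lamBond_of_lt {j : ℕ} (hj : D.k < j) (b : PBond P j) : ¬ D.LamBond j b := by
  simp [LamBond, D.Om_eq_empty hj]

/-- `Λ_j ≠ ∅` forces `j ≤ k` (sites). [cite: Balaban1984PropagatorsII, (2.3) p.224] -/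
theorem le_of_lamSite {j : ℕ} {y : Site P j} (h : D.LamSite j y) : j ≤ D.k :=
  not_lt.mp fun hj => D.not_lamSite_of_lt hj y h

/-- `Λ_j ≠ ∅` forces `j ≤ k` (bonds). [cite: Balaban1984PropagatorsII, (2.3) p.224] -/
theorem le_of_lamBond {j : ℕ} {b : PBond P j} (h : D.LamBond j b) : j ≤ D.k :=
  not_lt.mp fun hj => D.not_lamBond_of_lt hj b h

/-- `Λ_j ⊆ {y : y not inside Ω_{j+1}}` (sites in `Λ_j` are not deep). [cite: Balaban1984PropagatorsII, (2.3) p.224] -/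
theorem LamSite.not_deep {j : ℕ} {y : Site P j} (h : D.LamSite j y) : ¬ D.Deep j y := h.2

/-- NESTING (2.1) along the levels: `Ω_{j'} ⊆ Ω_j` for `j ≤ j'`, on fine sites. [cite: Balaban1984PropagatorsII, (2.1) p.224] -/
theorem inOm_of_le {j j' : ℕ} (hjj : j ≤ j') {x : Site P 0} (h : D.InOm j' x) : D.InOm j x := by
  induction j' with
  | zero =>
    obtain rfl : j = 0 := Nat.le_zero.mp hjj
    exact h
  | succ j' ih =>
    rcases Nat.lt_or_eq_of_le hjj with hlt | rfl
    · exact ih (Nat.lt_succ_iff.mp hlt) (D.nested _ (by simpa [InOm] using h))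
    · exact h

/-- a fine site of a `j`-block which is not inside `Ω_{j+1}` is outside `Ω_{j'}` for every `j' > j`. [cite: Balaban1984PropagatorsII, (2.1) p.224] -/
theorem not_inOm_of_not_deep {j j' : ℕ} (hjj : j < j') {x : Site P 0} (h : ¬ D.Deep j (iterBlockOf j x)) : ¬ D.InOm j' x :=
  fun h' => h (by simpa [Deep, InOm] using D.inOm_of_le (Nat.succ_le_of_lt hjj) h')

/-- **(2.7)/(2.10) `N(Q′)`**: *"λ = 0 on Λ₀, Q′_jλ = 0 on Λ_j, j = 1, …, k"* — `Q′_j = siteAvgIter j` (and `Q′₀ = id`).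
[cite: Balaban1984PropagatorsII, (2.7) p.224 + (2.10) p.225] -/
def InGauge (lam : SiteField P 0 ℝ) : Prop := ∀ (j : ℕ) (y : Site P j), D.LamSite j y → siteAvgIter j lam y = 0

/-- **(2.6)/(2.20) the constraints**: *"A = B₀ on Λ₀, Q_jA = B_j on Λ_j"*, *"(QA)(b) = (Q_jA)(b) for b ∈ Λ_j, (Q₀A)(b) = A(b)"* —
`Q_j = bondAvgIter j` (`Q₀ = id`), `B = (B_j)_j`. [cite: Balaban1984PropagatorsII, (2.6) p.224 + (2.20) p.226] -/
def Constr (A : VecField P 0 ℝ) (B : (j : ℕ) → VecField P j ℝ) : Prop :=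
  ∀ (j : ℕ) (b : PBond P j), D.LamBond j b → bondAvgIter j A b = B j b

/-- `N(Q′)` is a linear subspace of `L²(T_η)`. [cite: Balaban1984PropagatorsII, (2.10) p.225] -/
def gaugeSpace : Submodule ℝ (SiteField P 0 ℝ) where
  carrier := {lam | D.InGauge lam}
  zero_mem' j y _ := by rw [siteAvgIter_map_zero]; rfl
  add_mem' {f g} hf hg j y hy := by rw [siteAvgIter_add, Pi.add_apply, hf j y hy, hg j y hy, add_zero]
  smul_mem' a f hf j y hy := by rw [siteAvgIter_smul, Pi.smul_apply, hf j y hy, smul_zero]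

/-- membership in `gaugeSpace`. [cite: Balaban1984PropagatorsII, (2.10) p.225] -/
@[simp] theorem mem_gaugeSpace_iff (lam : SiteField P 0 ℝ) : lam ∈ D.gaugeSpace ↔ D.InGauge lam := Iff.rfl

/-! ## §2. Lemma S: `λ ∈ N(Q′)` forces `Q′_jλ = 0` on EVERY `j`-block not inside `Ω_{j+1}` (not only on `Λ_j`) -/

/-- **Lemma S.**  For `λ ∈ N(Q′)` and every level `j`: `(Q′_jλ)(y) = 0` for every `y ∈ T^{(j)}` not inside `Ω_{j+1}` — on
`Λ_j` by (2.7) itself, and on a `j`-block outside `Ω_j^{(j)}` because all its sub-blocks are again not inside `Ω_j`, so by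
induction their averages vanish (*"we assume that (Q′₀λ)(x) = λ(x), x ∈ Λ₀"*, p. 225).  In particular `Q′_kλ ≡ 0` on `T^{(k)}`.
[cite: Balaban1984PropagatorsII, (2.7) p.224 + (2.10) p.225] -/
theorem siteAvgIter_eq_zero_of_inGauge {lam : SiteField P 0 ℝ} (hlam : D.InGauge lam) :
    ∀ (j : ℕ) (y : Site P j), ¬ D.Deep j y → siteAvgIter j lam y = 0
  | 0, y, hy => hlam 0 y ((D.lamSite_zero_iff y).mpr hy)
  | j + 1, y, hy => by
    by_cases hmem : y ∈ D.Om (j + 1)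
    · exact hlam (j + 1) y ⟨hmem, hy⟩
    · have hsub : ∀ z : Site P j, blockOf z = y → siteAvgIter j lam z = 0 := fun z hz =>
        siteAvgIter_eq_zero_of_inGauge hlam j z (by simpa [Deep, hz] using hmem)
      rw [siteAvgIter_succ]
      by_cases hj : j + 1 ≤ P.m + P.K
      · exact siteAvg_eq_zero_of_local hj _ y hsub
      · -- outside the standing range `Ω_{j+1} = ∅`, so every `j`-block is "not deep" and `Q′_jλ ≡ 0`
        have hk : D.k < j + 1 := lt_of_le_of_lt D.hk (not_le.mp hj)
        have hall : siteAvgIter j lam = 0 := funext fun z =>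
          siteAvgIter_eq_zero_of_inGauge hlam j z (by simp [Deep, D.Om_eq_empty hk])
        rw [hall, siteAvg_zero]
        rfl

/-- Lemma S at the top level: `λ ∈ N(Q′) ⇒ Q′_kλ = 0` identically on `T^{(k)}`. [cite: Balaban1984PropagatorsII, (2.10) p.225] -/
theorem siteAvgIter_top_eq_zero_of_inGauge {lam : SiteField P 0 ℝ} (hlam : D.InGauge lam) : siteAvgIter D.k lam = 0 :=
  funext fun y => D.siteAvgIter_eq_zero_of_inGauge hlam D.k y (D.not_deep_of_le le_rfl y)

/-- `N(Q′)` described by the larger index set: `λ ∈ N(Q′)` iff `Q′_jλ(y) = 0` for all `j`-blocks `y` not inside `Ω_{j+1}`, all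
`j`. [cite: Balaban1984PropagatorsII, (2.10) p.225] -/
theorem inGauge_iff_forall_not_deep (lam : SiteField P 0 ℝ) :
    D.InGauge lam ↔ ∀ (j : ℕ) (y : Site P j), ¬ D.Deep j y → siteAvgIter j lam y = 0 :=
  ⟨fun h => D.siteAvgIter_eq_zero_of_inGauge h, fun h j y hy => h j y hy.2⟩

/-! ## §3. Lemma V: `QA = 0` forces `Q_jA = 0` on every `j`-bond with both end-points outside `Ω_{j+1}` -/

/-- **Lemma V.**  If `Q_jA = 0` on `Λ_j` for every `j` ((2.6) with `B = 0`), then `(Q_jA)(b) = 0` for every `j`-bond `b` whose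
two end-points are not inside `Ω_{j+1}` — on `Λ_j` by assumption, and for a bond with both end-points outside `Ω_j^{(j)}`
because `Q_j = Q∘Q_{j−1}` ((1.16)) averages `Q_{j−1}A` over the bonds of the straight contours, all of which join sub-blocks not
inside `Ω_j` (`bondAvg_eq_zero_of_local`).  In particular `Q_kA ≡ 0` on `T^{(k)}`. [cite: Balaban1984PropagatorsII, (2.6) p.224 + (2.20) p.226] -/
theorem bondAvgIter_eq_zero_of_constr_zero {A : VecField P 0 ℝ}
    (hA : ∀ (j : ℕ) (b : PBond P j), D.LamBond j b → bondAvgIter j A b = 0) :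
    ∀ (j : ℕ) (b : PBond P j), ¬ D.Deep j b.src → ¬ D.Deep j b.tgt → bondAvgIter j A b = 0
  | 0, b, hs, ht => hA 0 b ((D.lamBond_zero_iff b).mpr ⟨hs, ht⟩)
  | j + 1, b, hs, ht => by
    by_cases hmem : b.src ∈ D.Om (j + 1) ∨ b.tgt ∈ D.Om (j + 1)
    · exact hA (j + 1) b ⟨hmem, hs, ht⟩
    · obtain ⟨hm1, hm2⟩ := not_or.mp hmem
      have hnd : ∀ z : Site P j, (blockOf z = b.src ∨ blockOf z = b.tgt) → ¬ D.Deep j z := by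
        rintro z (hz | hz)
        · simpa [Deep, hz] using hm1
        · simpa [Deep, hz] using hm2
      rw [bondAvgIter_succ]
      by_cases hj : j + 1 ≤ P.m + P.K
      · exact bondAvg_eq_zero_of_local hj _ b fun b' h1 h2 =>
          bondAvgIter_eq_zero_of_constr_zero hA j b' (hnd _ h1) (hnd _ h2)
      · have hk : D.k < j + 1 := lt_of_le_of_lt D.hk (not_le.mp hj)
        have hall : bondAvgIter j A = 0 := funext fun b' =>
          bondAvgIter_eq_zero_of_constr_zero hA j b' (by simp [Deep, D.Om_eq_empty hk]) (by simp [Deep, D.Om_eq_empty hk])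
        rw [hall, bondAvg_zero]
        rfl

/-- Lemma V at the top level: `QA = 0 ⇒ Q_kA = 0` identically on `T^{(k)}`. [cite: Balaban1984PropagatorsII, (2.20) p.226] -/
theorem bondAvgIter_top_eq_zero_of_constr_zero {A : VecField P 0 ℝ}
    (hA : ∀ (j : ℕ) (b : PBond P j), D.LamBond j b → bondAvgIter j A b = 0) : bondAvgIter D.k A = 0 :=
  funext fun b => D.bondAvgIter_eq_zero_of_constr_zero hA D.k b (D.not_deep_of_le le_rfl _) (D.not_deep_of_le le_rfl _)

/-! ## §4. *"The functional and the conditions are invariant with respect to gauge transformations (2.7)"* (p. 224) -/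

/-- p. 227: *"Because Q′λ′ = 0, hence QA^{λ′} = QA − ∂₁Q′λ′ = QA"* — for `λ ∈ N(Q′)`, `(Q_jA^λ)(b) = (Q_jA)(b)` on every `j`-bond
with both end-points not inside `Ω_{j+1}` (in particular on `Λ_j`), `j ≤ k`: by (1.20) `Q_jA^λ = Q_jA − ∂^{(j)}Q′_jλ`
(`B5Eq120IterProof.eq120`) and Lemma S at both end-points. [cite: Balaban1984PropagatorsII, (2.7) p.224 + (2.29)–(2.30) p.227] -/
theorem bondAvgIter_gaugeShift_of_inGauge {lam : SiteField P 0 ℝ} (hlam : D.InGauge lam) (c : ℝ) (A : VecField P 0 ℝ)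
    {j : ℕ} (hj : j ≤ D.k) (b : PBond P j) (hs : ¬ D.Deep j b.src) (ht : ¬ D.Deep j b.tgt) :
    bondAvgIter j (gaugeShift c lam A) b = bondAvgIter j A b := by
  rw [B5Eq120IterProof.eq120 (hj.trans D.hk), D.siteAvgIter_eq_zero_of_inGauge hlam j _ hs, D.siteAvgIter_eq_zero_of_inGauge hlam j _ ht,
    sub_zero, smul_zero, sub_zero]

/-- **(2.6) is invariant under (2.7)** (p. 224: *"The functional and the conditions are invariant with respect to gauge
transformations λ: A → A^λ = A − ∂λ such that λ = 0 on Λ₀, Q′_jλ = 0 on Λ_j"*): for `λ ∈ N(Q′)`, `A` satisfies the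
constraints `Q_jA = B_j on Λ_j` iff `A^λ` does.  (The functional (2.5) is invariant under every `λ`:
`LatticeFieldCalculus.curlAction_gaugeShift`.) [cite: Balaban1984PropagatorsII, (2.6)–(2.7) p.224] -/
theorem constr_gaugeShift_iff {lam : SiteField P 0 ℝ} (hlam : D.InGauge lam) (c : ℝ) (A : VecField P 0 ℝ)
    (B : (j : ℕ) → VecField P j ℝ) : D.Constr (gaugeShift c lam A) B ↔ D.Constr A B := by
  refine forall₃_congr fun j b hb => ?_
  rw [D.bondAvgIter_gaugeShift_of_inGauge hlam c A (D.le_of_lamBond hb) b hb.2.1 hb.2.2]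

/-- (2.6)/(2.7) for the case `B = 0`: the homogeneous constraints are gauge invariant. [cite: Balaban1984PropagatorsII, (2.6)–(2.7) p.224] -/
theorem constr_zero_gaugeShift_iff {lam : SiteField P 0 ℝ} (hlam : D.InGauge lam) (c : ℝ) (A : VecField P 0 ℝ) :
    (∀ (j : ℕ) (b : PBond P j), D.LamBond j b → bondAvgIter j (gaugeShift c lam A) b = 0) ↔
      ∀ (j : ℕ) (b : PBond P j), D.LamBond j b → bondAvgIter j A b = 0 := by
  simpa [Constr] using D.constr_gaugeShift_iff hlam c A (fun _ => 0)

/-- the pure gauges `∂λ`, `λ ∈ N(Q′)`, satisfy the homogeneous constraints: `Q_j(∂λ) = ∂^{(j)}Q′_jλ = 0` on `Λ_j` ((1.20) and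
Lemma S). [cite: Balaban1984PropagatorsII, (2.7) p.224] -/
theorem bondAvgIter_grad_eq_zero_of_inGauge {lam : SiteField P 0 ℝ} (hlam : D.InGauge lam) (c : ℝ) {j : ℕ} (hj : j ≤ D.k)
    (b : PBond P j) (hs : ¬ D.Deep j b.src) (ht : ¬ D.Deep j b.tgt) : bondAvgIter j (grad c lam) b = 0 := by
  rw [bondAvgIter_grad j (hj.trans D.hk), grad, D.siteAvgIter_eq_zero_of_inGauge hlam j _ hs,
    D.siteAvgIter_eq_zero_of_inGauge hlam j _ ht, sub_zero, smul_zero]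

/-- … in particular on `Λ_j`. [cite: Balaban1984PropagatorsII, (2.7) p.224] -/
theorem constr_zero_grad {lam : SiteField P 0 ℝ} (hlam : D.InGauge lam) (c : ℝ) :
    ∀ (j : ℕ) (b : PBond P j), D.LamBond j b → bondAvgIter j (grad c lam) b = 0 := fun _ b hb =>
  D.bondAvgIter_grad_eq_zero_of_inGauge hlam c (D.le_of_lamBond hb) b hb.2.1 hb.2.2

/-! ## §5. (2.4): `T = ⋃_{j=0}^k B^j(Λ_j)` as a DISJOINT union — every fine site lies over exactly one `Λ_j` -/

/-- `x ∈ Ω₀ = T` for every fine site `x`. [cite: Balaban1984PropagatorsII, (2.4) p.224] -/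
theorem inOm_zero (x : Site P 0) : D.InOm 0 x := by
  simp [InOm, D.Om_zero]

/-- `Deep j (B^j-point of x)` is `x ∈ Ω_{j+1}`. [cite: Balaban1984PropagatorsII, (2.3) p.224] -/
theorem deep_iterBlockOf_iff (j : ℕ) (x : Site P 0) : D.Deep j (iterBlockOf j x) ↔ D.InOm (j + 1) x := Iff.rfl

/-- **(2.4), existence**: *"T = ⋃_{j=0}^k B^j(Λ_j)"* — every site of `T_η` lies in `B^j(Λ_j)` for some `j ≤ k` (the largest `j`
with `x ∈ Ω_j`). [cite: Balaban1984PropagatorsII, (2.4) p.224] -/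
theorem exists_lamSite_iterBlockOf (x : Site P 0) : ∃ j, j ≤ D.k ∧ D.LamSite j (iterBlockOf j x) := by
  classical
  set j₀ := Nat.findGreatest (fun j => D.InOm j x) D.k with hj₀
  have hle : j₀ ≤ D.k := Nat.findGreatest_le _
  have hP : D.InOm j₀ x := by
    by_cases h0 : j₀ = 0
    · rw [h0]; exact D.inOm_zero x
    · exact Nat.findGreatest_of_ne_zero hj₀.symm h0
  refine ⟨j₀, hle, hP, ?_⟩
  rw [deep_iterBlockOf_iff]
  intro hdeep
  rcases Nat.lt_or_eq_of_le hle with hlt | heq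
  · exact Nat.findGreatest_is_greatest (Nat.lt_succ_self j₀) (Nat.succ_le_of_lt hlt) hdeep
  · have : D.Om (j₀ + 1) = ∅ := D.Om_eq_empty (by omega)
    simp [InOm, this] at hdeep

/-- **(2.4), disjointness**: the sets `B^j(Λ_j)`, `j = 0, …, k`, are pairwise disjoint — a fine site lies over `Λ_j` for at most
one `j` (if `x ∈ B^{j'}(Λ_{j'})`, `j' > j`, then `x ∈ Ω_{j'} ⊆ Ω_{j+1}`, so its `j`-block is inside `Ω_{j+1}`). [cite: Balaban1984PropagatorsII, (2.4) p.224] -/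
theorem lamSite_iterBlockOf_unique {x : Site P 0} {j j' : ℕ} (h : D.LamSite j (iterBlockOf j x))
    (h' : D.LamSite j' (iterBlockOf j' x)) : j = j' := by
  by_contra hne
  wlog hlt : j < j' generalizing j j'
  · exact this h' h (Ne.symm hne) (lt_of_le_of_ne (not_lt.mp hlt) (Ne.symm hne))
  exact D.not_inOm_of_not_deep hlt h.2 h'.1

end Domains

end

end Literature.MathematicalPhysics.QuantumFieldTheory.Balaban1983to89.B6SectADomainsV1
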